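import Summits.CriticalPhenomena.PercolationContinuityZ3.Theorems.PercNearOneGluingNoHeavyPcintThirdBondUnits
import Summits.CriticalPhenomena.PercolationContinuityZ3.Theorems.PercNearOneGluingNoHeavyPcintMeanBondIneq
import HarnessLib

/-!
# PCINT lane, reduction B3m (`chordmean_cw`): corner-third units and the per-site bound with three units

Cell `prim-pcint` (PAPER-2 track (iii): certified intervals for `p_c(ℤ^d)`), seat `prim-pcint-2` (gen 4); support file
(`--supports stmt-CriticalPhenomena-4575`).  Does NOT build on p205010.  Memo: `run/shared/lean/prim/pcint/REDUCTIONS.md` §B3m.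

On top of the B3t units of `…ThirdBondUnits`, incidence `k ≥ 2` of an off-path site `w` is a CORNER-THIRD unit
(`c3UnitAt k`) when it pays a base unit and the previous incidence `k - 1` is at gap `2` with `w` the corner site of the two
steps after it and those steps perpendicular (stated as data: no geometry is needed downstream).  In a world `o` the unit is
BAD or GOOD with the corner coin `IsBad o γ (incAt (k-1))` (`c3bad`, `c3good`).  Counting (`count3_le`, `count3_le_of_first`,
`card_c3good_le`): the `t`-pairs, the bad corner-third pairs and the good pairs are disjoint families of consecutive pairs,
and the good corner-third pairs are good pairs other than the first.  With `…MeanBondIneq`: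
**`real_siteEvt_le_pow3`**: `P(siteEvt o γ w) ≤ s^{s3Units + 2·#badFiber} · t^{tUnits + #c3bad} · t'^{#c3good}`.
-/

noncomputable section

namespace Summit.CriticalPhenomena.PercolationContinuityZ3.Theorems.Pcint

open Finset MeasureTheory Literature.Probability.Percolation Literature.Probability.LatticeModels

variable {d n : ℕ}

namespace ChainBond

/-! ### Corner-third units -/

/-- The two steps `s, s+1` of the word are along different axes (`s + 2 ≤ n`). [folklore] -/
def StepsPerp (γ : Fin n → Fin d × Bool) (s : ℕ) : Prop :=
  ∃ h : s + 2 ≤ n, (γ ⟨s, by omega⟩).1 ≠ (γ ⟨s + 1, by omega⟩).1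

/-- `StepsPerp` is decidable. [folklore] -/
instance StepsPerp.decidable (γ : Fin n → Fin d × Bool) (s : ℕ) : Decidable (StepsPerp γ s) := by
  unfold StepsPerp
  by_cases h : s + 2 ≤ n
  · exact decidable_of_iff ((γ ⟨s, by omega⟩).1 ≠ (γ ⟨s + 1, by omega⟩).1) ⟨fun hp => ⟨h, hp⟩, fun ⟨_, hp⟩ => hp⟩
  · exact isFalse fun ⟨h', _⟩ => h h'

/-- Incidence `k` is a CORNER-THIRD unit: it pays a base unit, `k ≥ 2`, the previous incidence is at gap `2`, the site is the
corner site of the two steps after the previous incidence, and those steps are perpendicular. [folklore] -/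
def c3UnitAt (kc : ℕ) (γ : Fin n → Fin d × Bool) (w : Site d) (k : ℕ) : Prop :=
  paysAt kc γ w k ∧ 2 ≤ k ∧ incAt γ w k = incAt γ w (k - 1) + 2 ∧ cornerSite γ (incAt γ w (k - 1)) = w ∧
    StepsPerp γ (incAt γ w (k - 1))

/-- `c3UnitAt` is decidable. [folklore] -/
instance c3UnitAt.decidable (kc : ℕ) (γ : Fin n → Fin d × Bool) (w : Site d) (k : ℕ) : Decidable (c3UnitAt kc γ w k) := by
  unfold c3UnitAt; infer_instance

/-- The corner-third unit indices. [folklore] -/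
def c3Set (kc : ℕ) (γ : Fin n → Fin d × Bool) (w : Site d) : Finset ℕ :=
  (range (incTimes γ w).card).filter fun k => c3UnitAt kc γ w k

/-- Membership in `c3Set`. [folklore] -/
theorem mem_c3Set {kc : ℕ} {γ : Fin n → Fin d × Bool} {w : Site d} {k : ℕ} : k ∈ c3Set kc γ w ↔ c3UnitAt kc γ w k := by
  rw [c3Set, mem_filter, mem_range]
  exact ⟨fun h => h.2, fun h => ⟨h.1.2.1, h⟩⟩

/-- The number of corner-third units of the site. [folklore] -/
def c3Units (kc : ℕ) (γ : Fin n → Fin d × Bool) (w : Site d) : ℕ := (c3Set kc γ w).card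

/-- Corner-third units are base units. [folklore] -/
theorem c3Set_subset_paySet (kc : ℕ) (γ : Fin n → Fin d × Bool) (w : Site d) : c3Set kc γ w ⊆ paySet kc γ w :=
  fun _ hk => mem_paySet.2 (mem_c3Set.1 hk).1

/-- `t`-units and corner-third units are distinct incidences. [folklore] -/
theorem disjoint_tSet_c3Set (kc : ℕ) (γ : Fin n → Fin d × Bool) (w : Site d) : Disjoint (tSet kc γ w) (c3Set kc γ w) := by
  rw [disjoint_left]
  intro k ht hc
  have h1 := (mem_tSet.1 ht).2.2
  have h2 := (mem_c3Set.1 hc).2.2.1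
  omega

/-- `tUnits + c3Units ≤ detUnits`. [folklore] -/
theorem tUnits_add_c3Units_le (kc : ℕ) (γ : Fin n → Fin d × Bool) (w : Site d) :
    tUnits kc γ w + c3Units kc γ w ≤ detUnits kc γ w := by
  rw [tUnits, c3Units, ← card_union_of_disjoint (disjoint_tSet_c3Set kc γ w)]
  exact (card_le_card (union_subset (tSet_subset_paySet kc γ w) (c3Set_subset_paySet kc γ w))).trans
    (Nat.le_add_right _ _)

/-- The number of plain `s`-units of the site. [folklore] -/
def s3Units (kc : ℕ) (γ : Fin n → Fin d × Bool) (w : Site d) : ℕ := detUnits kc γ w - tUnits kc γ w - c3Units kc γ w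

/-- `s3Units + tUnits + c3Units = detUnits`. [folklore] -/
theorem s3Units_add (kc : ℕ) (γ : Fin n → Fin d × Bool) (w : Site d) :
    s3Units kc γ w + tUnits kc γ w + c3Units kc γ w = detUnits kc γ w := by
  have := tUnits_add_c3Units_le kc γ w; unfold s3Units; omega

open Classical in
/-- The BAD corner-third units of a world: the corner coin of the previous incidence is bad. [folklore] -/
def c3bad (o : Orders d n) (kc : ℕ) (γ : Fin n → Fin d × Bool) (w : Site d) : Finset ℕ :=
  (c3Set kc γ w).filter fun k => IsBad o γ (incAt γ w (k - 1))

open Classical in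
/-- The GOOD corner-third units of a world. [folklore] -/
def c3good (o : Orders d n) (kc : ℕ) (γ : Fin n → Fin d × Bool) (w : Site d) : Finset ℕ :=
  (c3Set kc γ w).filter fun k => ¬ IsBad o γ (incAt γ w (k - 1))

/-- Membership in `c3bad`. [folklore] -/
theorem mem_c3bad {o : Orders d n} {kc : ℕ} {γ : Fin n → Fin d × Bool} {w : Site d} {k : ℕ} :
    k ∈ c3bad o kc γ w ↔ k ∈ c3Set kc γ w ∧ IsBad o γ (incAt γ w (k - 1)) := by
  classical
  unfold c3bad; rw [mem_filter]

/-- Membership in `c3good`. [folklore] -/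
theorem mem_c3good {o : Orders d n} {kc : ℕ} {γ : Fin n → Fin d × Bool} {w : Site d} {k : ℕ} :
    k ∈ c3good o kc γ w ↔ k ∈ c3Set kc γ w ∧ ¬ IsBad o γ (incAt γ w (k - 1)) := by
  classical
  unfold c3good; rw [mem_filter]

/-- Bad and good corner-third units partition the corner-third units. [folklore] -/
theorem card_c3bad_add_card_c3good (o : Orders d n) (kc : ℕ) (γ : Fin n → Fin d × Bool) (w : Site d) :
    (c3bad o kc γ w).card + (c3good o kc γ w).card = c3Units kc γ w := by
  classical
  unfold c3bad c3good c3Units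
  convert card_filter_add_card_filter_not (s := c3Set kc γ w) (fun k => IsBad o γ (incAt γ w (k - 1)))

/-! ### Counting -/

open Classical in
/-- The bad corner-third pairs, indexed by their lower index. [folklore] -/
theorem image_c3bad_subset (o : Orders d n) (kc : ℕ) (γ : Fin n → Fin d × Bool) (w : Site d) :
    (c3bad o kc γ w).image (· - 1) ⊆ ((range ((incTimes γ w).card - 1)).erase 0).filter
      fun j => incAt γ w (j + 1) = incAt γ w j + 2 ∧ (cornerSite γ (incAt γ w j) = w ∧ IsBad o γ (incAt γ w j)) := by
  classical
  intro j hj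
  obtain ⟨k, hk, rfl⟩ := mem_image.1 hj
  obtain ⟨hk3, hbad⟩ := mem_c3bad.1 hk
  obtain ⟨⟨_, hkr, -, -⟩, hk2, hgap, hC, -⟩ := mem_c3Set.1 hk3
  refine mem_filter.2 ⟨mem_erase.2 ⟨by omega, mem_range.2 (by omega)⟩, ?_, hC, hbad⟩
  rw [show k - 1 + 1 = k by omega]; exact hgap

/-- `#(c3bad.image (· - 1)) = #c3bad`. [folklore] -/
theorem card_image_c3bad (o : Orders d n) (kc : ℕ) (γ : Fin n → Fin d × Bool) (w : Site d) :
    ((c3bad o kc γ w).image (· - 1)).card = (c3bad o kc γ w).card := by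
  classical
  refine card_image_of_injOn fun k hk k' hk' h => ?_
  have h2 := (mem_c3Set.1 (mem_c3bad.1 (mem_coe.1 hk)).1).2.1
  have h2' := (mem_c3Set.1 (mem_c3bad.1 (mem_coe.1 hk')).1).2.1
  omega

/-- **Counting**: good pairs, `t`-pairs and bad corner-third pairs are disjoint: `g + tUnits + #c3bad + 1 ≤ r` (or `r = 0`).
[folklore] -/
theorem count3_le (o : Orders d n) (kc : ℕ) (γ : Fin n → Fin d × Bool) (w : Site d) :
    (goodSet o γ w).card + tUnits kc γ w + (c3bad o kc γ w).card + 1 ≤ (incTimes γ w).card ∨ (incTimes γ w).card = 0 := by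
  classical
  set r := (incTimes γ w).card with hr
  by_cases hr0 : r = 0
  · exact Or.inr hr0
  left
  have hd1 : Disjoint (goodSet o γ w) ((tSet kc γ w).image (· - 1)) := by
    rw [Finset.disjoint_left]; intro j hg ht
    have h1 := (mem_filter.1 hg).2.1
    have h2 := (mem_filter.1 (image_tSet_subset kc γ w ht)).2
    omega
  have hd2 : Disjoint (goodSet o γ w ∪ (tSet kc γ w).image (· - 1)) ((c3bad o kc γ w).image (· - 1)) := by
    rw [Finset.disjoint_left]; intro j hj hc
    obtain ⟨-, -, hCb⟩ := mem_filter.1 (image_c3bad_subset o kc γ w hc)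
    rcases mem_union.1 hj with hg | ht
    · exact (mem_filter.1 hg).2.2 hCb
    · have h2 := (mem_filter.1 (image_tSet_subset kc γ w ht)).2
      have h3 := (mem_filter.1 (image_c3bad_subset o kc γ w hc)).2.1
      omega
  have hsub : goodSet o γ w ∪ (tSet kc γ w).image (· - 1) ∪ (c3bad o kc γ w).image (· - 1) ⊆ range (r - 1) :=
    union_subset (union_subset (fun j hj => (mem_filter.1 hj).1)
      fun j hj => mem_of_mem_erase (mem_filter.1 (image_tSet_subset kc γ w hj)).1)
      fun j hj => mem_of_mem_erase (mem_filter.1 (image_c3bad_subset o kc γ w hj)).1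
  have := card_le_card hsub
  rw [card_union_of_disjoint hd2, card_union_of_disjoint hd1, card_image_tSet, card_image_c3bad, card_range] at this
  omega

/-- **Counting, first pair not good**: `g + tUnits + #c3bad + 2 ≤ r`. [folklore] -/
theorem count3_le_of_first {o : Orders d n} {kc : ℕ} {γ : Fin n → Fin d × Bool} {w : Site d} (hr : 2 ≤ (incTimes γ w).card)
    (h0 : ¬ (incAt γ w 1 = incAt γ w 0 + 2 ∧ ¬ (cornerSite γ (incAt γ w 0) = w ∧ IsBad o γ (incAt γ w 0)))) :
    (goodSet o γ w).card + tUnits kc γ w + (c3bad o kc γ w).card + 2 ≤ (incTimes γ w).card := by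
  classical
  set r := (incTimes γ w).card with hr'
  have hd1 : Disjoint (goodSet o γ w) ((tSet kc γ w).image (· - 1)) := by
    rw [Finset.disjoint_left]; intro j hg ht
    have h1 := (mem_filter.1 hg).2.1
    have h2 := (mem_filter.1 (image_tSet_subset kc γ w ht)).2
    omega
  have hd2 : Disjoint (goodSet o γ w ∪ (tSet kc γ w).image (· - 1)) ((c3bad o kc γ w).image (· - 1)) := by
    rw [Finset.disjoint_left]; intro j hj hc
    obtain ⟨-, -, hCb⟩ := mem_filter.1 (image_c3bad_subset o kc γ w hc)
    rcases mem_union.1 hj with hg | ht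
    · exact (mem_filter.1 hg).2.2 hCb
    · have h2 := (mem_filter.1 (image_tSet_subset kc γ w ht)).2
      have h3 := (mem_filter.1 (image_c3bad_subset o kc γ w hc)).2.1
      omega
  have hsub : goodSet o γ w ∪ (tSet kc γ w).image (· - 1) ∪ (c3bad o kc γ w).image (· - 1) ⊆ (range (r - 1)).erase 0 := by
    refine union_subset (union_subset (fun j hj => ?_)
      fun j hj => (mem_filter.1 (image_tSet_subset kc γ w hj)).1)
      fun j hj => (mem_filter.1 (image_c3bad_subset o kc γ w hj)).1
    obtain ⟨hj1, hj2⟩ := mem_filter.1 hj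
    refine mem_erase.2 ⟨fun hj0 => ?_, hj1⟩
    subst hj0; exact h0 hj2
  have := card_le_card hsub
  rw [card_union_of_disjoint hd2, card_union_of_disjoint hd1, card_image_tSet, card_image_c3bad,
    card_erase_of_mem (mem_range.2 (by omega)), card_range] at this
  omega

/-- **Good corner-third units are good pairs other than the first**: `#c3good ≤ #(goodSet.erase 0)`. [folklore] -/
theorem card_c3good_le (o : Orders d n) (kc : ℕ) (γ : Fin n → Fin d × Bool) (w : Site d) :
    (c3good o kc γ w).card ≤ ((goodSet o γ w).erase 0).card := by
  classical
  refine card_le_card_of_injOn (· - 1) (fun k hk => ?_) fun k hk k' hk' h => ?_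
  · obtain ⟨hk3, hgood⟩ := mem_c3good.1 (mem_coe.1 hk)
    obtain ⟨⟨_, hkr, -, -⟩, hk2, hgap, -, -⟩ := mem_c3Set.1 hk3
    show k - 1 ∈ (↑((goodSet o γ w).erase 0) : Set ℕ)
    rw [mem_coe, mem_erase, goodSet, mem_filter, mem_range]
    refine ⟨by omega, by omega, ?_, fun h => hgood h.2⟩
    rw [show k - 1 + 1 = k by omega]; exact hgap
  · have h2 := (mem_c3Set.1 (mem_c3good.1 (mem_coe.1 hk)).1).2.1
    have h2' := (mem_c3Set.1 (mem_c3good.1 (mem_coe.1 hk')).1).2.1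
    simp only at h; omega

/-! ### The per-site bound with three units -/

/-- **Per-site bound in units (B3m)**: `P(siteEvt o γ w) ≤ s^{s3Units + 2·#badFiber} · t^{tUnits + #c3bad} · t'^{#c3good}`
for reals with `0 ≤ p ≤ 1`, `1 - p² ≤ s²`, `s ≤ 1`, `0 ≤ t ≤ t' ≤ s`, `(1-p)(1+2p) ≤ t(1+p)`, `p² ≤ (t'-t)(1+p)`, and
`kc ≥ 2`. [folklore] -/
theorem real_siteEvt_le_pow3 (p : unitInterval) {s t t' : ℝ} (hps : 1 - (p : ℝ) ^ 2 ≤ s ^ 2) (hs1 : s ≤ 1) (ht0 : 0 ≤ t)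
    (htt : t ≤ t') (hts : t' ≤ s) (htp : (1 - (p : ℝ)) * (1 + 2 * p) ≤ t * (1 + p))
    (hgap : (p : ℝ) ^ 2 ≤ (t' - t) * (1 + p)) {kc : ℕ} (hkc : 2 ≤ kc) {o : Orders d n} {γ : Fin n → Fin d × Bool}
    (hsaw : IsSAW γ) {w : Site d} (hw : w ∉ pathSites γ) :
    (bondPercolation (zdGraph d) p).real (siteEvt o γ w) ≤
      s ^ (s3Units kc γ w + 2 * (badFiber o γ w).card) * t ^ (tUnits kc γ w + (c3bad o kc γ w).card) *
        t' ^ (c3good o kc γ w).card := by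
  classical
  have hp0 : (0 : ℝ) ≤ p := p.2.1
  have hp1 : (p : ℝ) ≤ 1 := p.2.2
  set r := (incTimes γ w).card with hr
  have hunits := detUnits_add_le hkc γ w
  have hfib := card_badFiber_le_one o γ w
  have hP := real_siteEvt_le_siteProb p (o := o) hsaw hw
  have hsum := s3Units_add kc γ w
  have hbg := card_c3bad_add_card_c3good o kc γ w
  rw [← hr] at hP hunits
  by_cases hr1 : r ≤ 1
  · have hdu : detUnits kc γ w = 0 := detUnits_eq_zero_of_card_le_one (by rw [← hr]; exact hr1)
    have htu : tUnits kc γ w = 0 := by have := tUnits_add_c3Units_le kc γ w; omega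
    have hcu : c3Units kc γ w = 0 := by have := tUnits_add_c3Units_le kc γ w; omega
    have hsu : s3Units kc γ w = 0 := by unfold s3Units; omega
    have hb0 : (c3bad o kc γ w).card = 0 := by omega
    have hg0 : (c3good o kc γ w).card = 0 := by omega
    have hbf : badFiber o γ w = ∅ := by
      rw [Finset.eq_empty_iff_forall_notMem]
      intro x hx
      have := (eq_incAt_zero_of_mem_badFiber hx).2.1.1
      omega
    simp only [htu, hsu, hb0, hg0, hbf, card_empty, mul_zero, add_zero, pow_zero, mul_one]
    exact measureReal_le_one
  obtain ⟨m, hm⟩ : ∃ m, r = m + 2 := ⟨r - 2, by omega⟩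
  rw [hm] at hP
  have hcount := count3_le o kc γ w
  have hc3g := card_c3good_le o kc γ w
  rw [← hr] at hcount
  by_cases h0 : incAt γ w 1 = incAt γ w 0 + 2 ∧ ¬ (cornerSite γ (incAt γ w 0) = w ∧ IsBad o γ (incAt γ w 0))
  · have hbf : badFiber o γ w = ∅ := by
      rw [Finset.eq_empty_iff_forall_notMem]
      intro x hx
      obtain ⟨hx0, -, hbad⟩ := eq_incAt_zero_of_mem_badFiber hx
      have hcw : cornerSite γ (incAt γ w 0) = w := by rw [← hx0]; exact (mem_filter.1 hx).2
      exact h0.2 ⟨hcw, by rw [← hx0]; exact hbad⟩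
    have hfc : firstCorner γ w := ⟨by rw [← hr]; omega, h0.1⟩
    rw [if_pos hfc] at hunits
    have hg0 : 0 ∈ goodSet o γ w := by
      rw [goodSet, mem_filter, mem_range]; exact ⟨by rw [← hr]; omega, h0⟩
    have hg1 : 1 ≤ (goodSet o γ w).card := card_pos.2 ⟨0, hg0⟩
    have hge : ((goodSet o γ w).erase 0).card + 1 = (goodSet o γ w).card := card_erase_add_one hg0
    rw [hbf, card_empty, mul_zero, add_zero]
    refine hP.trans (siteProb_le_pow3_of_first_good hp0 hp1 hs1 ht0 htt hts htp hgap hg1 ?_ ?_ ?_)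
    · rcases hcount with h | h <;> omega
    · omega
    · omega
  · have hg := count3_le_of_first (kc := kc) (o := o) (by rw [← hr]; omega) h0
    rw [← hr] at hg
    have hge : ((goodSet o γ w).erase 0).card ≤ (goodSet o γ w).card := card_erase_le
    refine hP.trans (siteProb_le_pow3_of_first_bad hp0 hp1 hps hs1 ht0 htt hts htp hgap (by omega) (by omega) ?_)
    by_cases hne : (badFiber o γ w).Nonempty
    · obtain ⟨x, hx⟩ := hne
      obtain ⟨-, hfc, -⟩ := eq_incAt_zero_of_mem_badFiber hx
      have hcard1 : (badFiber o γ w).card = 1 := le_antisymm hfib (card_pos.2 ⟨x, hx⟩)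
      rw [if_pos hfc] at hunits
      rw [hcard1]; omega
    · rw [Finset.not_nonempty_iff_eq_empty] at hne
      rw [hne, card_empty]
      split_ifs at hunits <;> omega

/-! ### Totals -/

/-- Total number of corner-third units of a word. [folklore] -/
def c3Total (kc : ℕ) (γ : Fin n → Fin d × Bool) : ℕ := ∑ w ∈ offSites γ, c3Units kc γ w

/-- Total number of plain `s`-units of a word (B3m). [folklore] -/
def s3Total (kc : ℕ) (γ : Fin n → Fin d × Bool) : ℕ := ∑ w ∈ offSites γ, s3Units kc γ w

/-- `s3Total + tTotal + c3Total = detTotal`. [folklore] -/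
theorem s3Total_add (kc : ℕ) (γ : Fin n → Fin d × Bool) : s3Total kc γ + tTotal kc γ + c3Total kc γ = detTotal kc γ := by
  rw [s3Total, tTotal, c3Total, detTotal, ← sum_add_distrib, ← sum_add_distrib]
  exact sum_congr rfl fun w _ => s3Units_add kc γ w

/-- The symmetric (order-averaged) B3m weight of a word:
`pⁿ (1-p)^{#chords} s^{s3Total} t^{tTotal} ((t+t')/2)^{c3Total} ((1+s²)/2)^{cornerTotal}`. [folklore] -/
def meanBondWeight (p s t t' : ℝ) (kc : ℕ) (γ : Fin n → Fin d × Bool) : ℝ :=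
  p ^ n * (1 - p) ^ (chordEdges γ).card * s ^ s3Total kc γ * t ^ tTotal kc γ * ((t + t') / 2) ^ c3Total kc γ *
    ((1 + s ^ 2) / 2) ^ cornerTotal γ

end ChainBond

end Summit.CriticalPhenomena.PercolationContinuityZ3.Theorems.Pcint
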